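import Mathlib
import Summits.ValiantsHypothesis.ValiantsHypothesis.Theses.ChowBorderDepth3
import Summits.ValiantsHypothesis.ValiantsHypothesis.Theorems.ChowBorderDepth3LocalFanInTwoNewton

/-!
# Stub `stub_gradedOfLocal` of crux `ChowBorderDepth3.ChowBorderBound`
# (stmt-ValiantsHypothesis-5936), line `registered` (vertex normal form)

**What is proved.**  Work over `R = ℂ[ε]` (`ε = Polynomial.X`) in the `n²` variables `x_v`,
`v : Fin n × Fin n`.  Suppose the padded permanent has a *local* (vertex normal form) border
`ΣΠΣ` expression

  `Σ_i a_i Π_j (1 + u_{ij}) = ε^q · per_n + ε^{q+1} · G`,   `u_{ij} = Σ_v m_{ijv} x_v`,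

in which every coefficient `m_{ijv}` of every linear form is divisible by `ε`.  Then, writing
`m_{ijv} = ε · m'_{ijv}` and `u'_{ij} = Σ_v m'_{ijv} x_v`, the *graded* system

  `ε^d · Σ_i a_i e_d(u'_{i,1}, …, u'_{i,D}) = [d = n] · ε^q · per_n + ε^{q+1} · G_d`
  (all `d : ℕ`)

holds, where `e_d(u'_i) = Σ_{|A| = d} Π_{j ∈ A} u'_{ij}` is the `d`-th elementary symmetric
polynomial of the linear forms and `G_d` is the degree-`d` homogeneous component of `G`.

**Proof.**  Apply `homogeneousComponent d` to the identity.  On the left, by linearity and the tree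
lemma `homogeneousComponent_prod_one_add` (the degree-`d` part of `Π_j (1 + u_j)` for linear forms
`u_j` is `e_d(u)`, made explicit by `aeval_esymm_eq`), one gets `Σ_i a_i e_d(u_i)`; since
`u_{ij} = ε · u'_{ij}` and every `A` in the sum has `|A| = d`, `e_d(u_i) = ε^d · e_d(u'_i)`.
On the right, `per_n` is homogeneous of degree `n` (`perPoly_isHomogeneous`), so its degree-`d`
component is `[d = n] · per_n`, and `homogeneousComponent d` commutes with the scalars `ε^q`,
`ε^{q+1}`.

References: folklore (grading a homogeneous identity by degree); I. G. Macdonald, *Symmetric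
functions and Hall polynomials*, 2nd ed., OUP 1995, §I.2, for `Π_j (1 + u_j t) = Σ_d e_d(u) t^d`.
-/

noncomputable section

-- `Summit.ValiantsHypothesis.ValiantsHypothesis.…` is the tree's mandated single-conjunct layout
-- (Sub = Summit), so the duplicated namespace component is intended.
set_option linter.dupNamespace false

namespace Summit.ValiantsHypothesis.ValiantsHypothesis.Theorems.ChowBorderBound.GradedOfLocal

open MvPolynomial Literature.Computability.AlgebraicComplexity
open Summit.ValiantsHypothesis.ValiantsHypothesis.Theorems.ChowBorderDepth3LocalFanInTwo
open scoped Polynomial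

/-- A linear form `Σ_v c_v x_v` (constant-free) is homogeneous of degree `1`. [folklore] -/
theorem isHomogeneous_one_linearForm {σ R : Type*} [CommSemiring R] [Fintype σ] (c : σ → R) :
    (∑ v, C (c v) * X v : MvPolynomial σ R).IsHomogeneous 1 := by
  refine IsHomogeneous.sum _ _ _ fun v _ => ?_
  have := (isHomogeneous_C σ (c v)).mul (isHomogeneous_X R v)
  rwa [zero_add] at this

/-- Pulling a common scalar out of a linear form: `Σ_v (t c_v) x_v = t · Σ_v c_v x_v`.
[folklore] -/
theorem linearForm_mul_left {σ R : Type*} [CommSemiring R] [Fintype σ] (t : R) (c : σ → R) :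
    (∑ v, C (t * c v) * X v : MvPolynomial σ R) = C t * ∑ v, C (c v) * X v := by
  rw [Finset.mul_sum]
  refine Finset.sum_congr rfl fun v _ => ?_
  rw [C_mul, mul_assoc]

/-- The degree-`d` elementary symmetric polynomial is homogeneous of degree `d` in a common
scalar of its arguments: `Σ_{|A|=d} Π_{j∈A} (t · w_j) = t^d · Σ_{|A|=d} Π_{j∈A} w_j`.
[folklore] -/
theorem sum_powersetCard_prod_C_mul {σ R : Type*} [CommSemiring R] {D : ℕ} (t : R)
    (w : Fin D → MvPolynomial σ R) (d : ℕ) :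
    (∑ A ∈ Finset.powersetCard d (Finset.univ : Finset (Fin D)), ∏ j ∈ A, C t * w j) =
      C (t ^ d) *
        ∑ A ∈ Finset.powersetCard d (Finset.univ : Finset (Fin D)), ∏ j ∈ A, w j := by
  rw [Finset.mul_sum]
  refine Finset.sum_congr rfl fun A hA => ?_
  rw [Finset.prod_mul_distrib, Finset.prod_const, (Finset.mem_powersetCard.1 hA).2, C_pow]

/-- **Stub `stub_gradedOfLocal`** (registered stub of crux stmt-ValiantsHypothesis-5936, line
`registered`): a local (vertex normal form) border `ΣΠΣ` expression
`Σ_i a_i Π_j (1 + u_{ij}) = ε^q per_n + ε^{q+1} G` over `ℂ[ε]`, all of whose linear forms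
`u_{ij}` have coefficients divisible by `ε`, yields — after writing `u_{ij} = ε u'_{ij}` and
taking homogeneous components of each degree `d` — the graded system
`ε^d Σ_i a_i e_d(u'_i) = [d = n] ε^q per_n + ε^{q+1} G_d` for all `d`. [folklore] -/
theorem stub_gradedOfLocal :
    ∀ n r D : ℕ,
    (∃ (q : ℕ) (a : Fin r → Polynomial ℂ) (m : Fin r → Fin D → Fin n × Fin n → Polynomial ℂ)
        (G : MvPolynomial (Fin n × Fin n) (Polynomial ℂ)),
        (∀ i j v, Polynomial.X ∣ m i j v) ∧
        (∑ i, MvPolynomial.C (a i) *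
            ∏ j, (1 + ∑ v, MvPolynomial.C (m i j v) * MvPolynomial.X v)) =
          MvPolynomial.C (Polynomial.X ^ q) *
              MvPolynomial.map Polynomial.C
                (Literature.Computability.AlgebraicComplexity.perPoly (Fin n) ℂ) +
            MvPolynomial.C (Polynomial.X ^ (q + 1)) * G) →
    ∃ (q : ℕ) (a : Fin r → Polynomial ℂ) (m : Fin r → Fin D → Fin n × Fin n → Polynomial ℂ)
      (G : ℕ → MvPolynomial (Fin n × Fin n) (Polynomial ℂ)),
      ∀ d : ℕ, MvPolynomial.C (Polynomial.X ^ d) *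
          (∑ i, MvPolynomial.C (a i) *
            ∑ A ∈ Finset.powersetCard d (Finset.univ : Finset (Fin D)),
              ∏ j ∈ A, ∑ v, MvPolynomial.C (m i j v) * MvPolynomial.X v) =
        (if d = n then
            MvPolynomial.C (Polynomial.X ^ q) *
              MvPolynomial.map Polynomial.C
                (Literature.Computability.AlgebraicComplexity.perPoly (Fin n) ℂ)
          else 0) +
          MvPolynomial.C (Polynomial.X ^ (q + 1)) * G d := by
  classical
  rintro n r D ⟨q, a, m, G, hm, hid⟩
  -- write every coefficient as `ε * m'`
  choose m' hm' using hm
  refine ⟨q, a, m', fun d => homogeneousComponent d G, fun d => ?_⟩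
  -- the linear forms factor as `u_{ij} = ε · u'_{ij}`
  have hfac : ∀ i j, (∑ v, C (m i j v) * X v : MvPolynomial (Fin n × Fin n) ℂ[X]) =
      C Polynomial.X * ∑ v, C (m' i j v) * X v := by
    intro i j
    rw [← linearForm_mul_left]
    exact Finset.sum_congr rfl fun v _ => by rw [← hm' i j v]
  -- left-hand side: degree-`d` component of the local expression
  have hL : homogeneousComponent d
      (∑ i, C (a i) * ∏ j, (1 + ∑ v, C (m i j v) * X v) :
        MvPolynomial (Fin n × Fin n) ℂ[X]) =
      C (Polynomial.X ^ d) * ∑ i, C (a i) *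
        ∑ A ∈ Finset.powersetCard d (Finset.univ : Finset (Fin D)),
          ∏ j ∈ A, ∑ v, C (m' i j v) * X v := by
    rw [map_sum, Finset.mul_sum]
    refine Finset.sum_congr rfl fun i _ => ?_
    rw [homogeneousComponent_C_mul,
      homogeneousComponent_prod_one_add (fun j => ∑ v, C (m i j v) * X v)
        (fun j => isHomogeneous_one_linearForm (m i j)) d,
      aeval_esymm_eq, mul_left_comm, ← sum_powersetCard_prod_C_mul]
    simp only [hfac]
  -- right-hand side: degree-`d` component of `ε^q per_n + ε^{q+1} G`
  have hR : homogeneousComponent d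
      (C (Polynomial.X ^ q) * MvPolynomial.map Polynomial.C (perPoly (Fin n) ℂ) +
        C (Polynomial.X ^ (q + 1)) * G : MvPolynomial (Fin n × Fin n) ℂ[X]) =
      (if d = n then C (Polynomial.X ^ q) * MvPolynomial.map Polynomial.C (perPoly (Fin n) ℂ)
        else 0) + C (Polynomial.X ^ (q + 1)) * homogeneousComponent d G := by
    rw [map_add, homogeneousComponent_C_mul, homogeneousComponent_C_mul,
      homogeneousComponent_of_mem
        ((perPoly_isHomogeneous (n := Fin n) (k := ℂ)).map Polynomial.C),
      Fintype.card_fin, mul_ite, mul_zero]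
  rw [← hL, hid, hR]

end Summit.ValiantsHypothesis.ValiantsHypothesis.Theorems.ChowBorderBound.GradedOfLocal

end
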